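import Summits.CriticalPhenomena.CardyFormulaZ2.Theses.CardyBoundaryCoulombGas
import Summits.CriticalPhenomena.CardyFormulaZ2.Theorems.RectilinearCardy.Negative.RectilinearCardyReductions

/-!
# Stub `stub_finiteCorners` of line `excursion-kernel-covariance`
# (crux `RectilinearCardy`, stmt-CriticalPhenomena-5660, route `CardyBoundaryCoulombGas`)

Plane topology of rectilinear Jordan polygons ("finite corners"): if the frontier of a conformal
rectangle `R` lies in finitely many axis-parallel closed segments (`IsRectilinear R`), then all but
finitely many parameters `s` of the arc `[mark 1, mark 3]` are FLAT points: near `z = R.boundary s`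
the whole frontier lies on the horizontal, or on the vertical, line through `z`.

Proof. Let `S` be the finite family of axis-parallel segments. The only candidate corners are the
grid points `⟨q.1.re, p.1.im⟩`, `p, q ∈ S` (the unique possible common point of a horizontal-type
segment `p` and a vertical-type segment `q`), a finite set `G`. Fix `z ∉ G`. The union `K` of the
segments of `S` missing `z` is closed and misses `z`, so some ball `B(z, r)`, `r > 0`, misses `K`:
every segment of `S` through a point of the frontier in `B(z, r)` passes through `z`. If some
horizontal-type segment of `S` passes through `z`, then every segment of `S` through `z` is
horizontal-type (a vertical-type one would make `z` a grid point), so the frontier in `B(z, r)` has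
constant imaginary part `z.im`; otherwise every segment through `z` is vertical-type and the frontier
in `B(z, r)` has constant real part `z.re`. Finally `boundary` is injective on
`[mark 1, mark 3] ⊆ [0, 1)`, so only finitely many parameters of the arc are sent into `G`.
-/

noncomputable section

open Set Filter Topology

namespace Summit.CriticalPhenomena.CardyFormulaZ2.Cruxes.RectilinearCardy.ExcursionKernelCovariance

open Literature.Probability.RandomPlanarGeometry
open Summit.CriticalPhenomena.CardyFormulaZ2.Theorems.RectilinearCardy.Negative (IsRectilinear)

/-- **Flatness off the grid.** Let `S` be a finite family of axis-parallel segments of `ℂ` covering a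
set `F`, and let `z` be a point which is not a grid point `⟨q.1.re, p.1.im⟩` (`p, q ∈ S`). Then for
some `r > 0`, every point of `F` within `r` of `z` has imaginary part `z.im`, or every such point has
real part `z.re`. [folklore] -/
theorem exists_flat_near_of_not_mem_grid {S : Finset (ℂ × ℂ)} {F : Set ℂ}
    (hS : ∀ p ∈ S, p.1.re = p.2.re ∨ p.1.im = p.2.im) (hF : F ⊆ ⋃ p ∈ S, segment ℝ p.1 p.2)
    {z : ℂ} (hz : z ∉ (S ×ˢ S).image fun pq : (ℂ × ℂ) × (ℂ × ℂ) => (⟨pq.2.1.re, pq.1.1.im⟩ : ℂ)) :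
    ∃ r : ℝ, 0 < r ∧ ((∀ z' ∈ F, dist z' z < r → z'.im = z.im) ∨
      (∀ z' ∈ F, dist z' z < r → z'.re = z.re)) := by
  classical
  -- points of a segment with endpoints of equal imaginary (real) part have that imaginary (real) part
  have him : ∀ {a b w : ℂ}, a.im = b.im → w ∈ segment ℝ a b → w.im = a.im := by
    rintro a b w h ⟨t₁, t₂, -, -, hsum, rfl⟩
    simp only [Complex.add_im, Complex.smul_im, smul_eq_mul]
    linear_combination (-t₂) * h + a.im * hsum
  have hre : ∀ {a b w : ℂ}, a.re = b.re → w ∈ segment ℝ a b → w.re = a.re := by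
    rintro a b w h ⟨t₁, t₂, -, -, hsum, rfl⟩
    simp only [Complex.add_re, Complex.smul_re, smul_eq_mul]
    linear_combination (-t₂) * h + a.re * hsum
  -- the union `K` of the (closed) segments of `S` missing `z` is closed and misses `z`
  set K : Set ℂ := ⋃ p ∈ S.filter (fun p => z ∉ segment ℝ p.1 p.2), segment ℝ p.1 p.2 with hK
  have hKc : IsClosed K := by
    refine isClosed_biUnion_finset fun p _ => ?_
    rw [segment_eq_image_lineMap]
    exact (isCompact_Icc.image AffineMap.lineMap_continuous).isClosed
  have hzK : z ∉ K := by
    intro h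
    obtain ⟨p, hp, hzp⟩ := mem_iUnion₂.1 h
    exact (Finset.mem_filter.1 hp).2 hzp
  obtain ⟨r, hr, hball⟩ := Metric.mem_nhds_iff.1 (hKc.isOpen_compl.mem_nhds hzK)
  -- every segment of `S` through a point of `F` within `r` of `z` passes through `z`
  have key : ∀ z' ∈ F, dist z' z < r →
      ∃ q ∈ S, z ∈ segment ℝ q.1 q.2 ∧ z' ∈ segment ℝ q.1 q.2 := by
    intro z' hz' hd
    obtain ⟨q, hq, hz'q⟩ := mem_iUnion₂.1 (hF hz')
    refine ⟨q, hq, by_contra fun hzq => hball (Metric.mem_ball.2 hd) ?_, hz'q⟩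
    exact mem_iUnion₂.2 ⟨q, Finset.mem_filter.2 ⟨hq, hzq⟩, hz'q⟩
  refine ⟨r, hr, ?_⟩
  by_cases hh : ∃ p ∈ S, z ∈ segment ℝ p.1 p.2 ∧ p.1.im = p.2.im
  · -- a horizontal-type segment passes through `z`: all segments through `z` are horizontal-type
    obtain ⟨p, hp, hzp, hpim⟩ := hh
    refine Or.inl fun z' hz' hd => ?_
    obtain ⟨q, hq, hzq, hz'q⟩ := key z' hz' hd
    rcases hS q hq with hqre | hqim
    · refine absurd (Finset.mem_image.2 ⟨(p, q), Finset.mem_product.2 ⟨hp, hq⟩, ?_⟩) hz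
      exact Complex.ext (hre hqre hzq).symm (him hpim hzp).symm
    · rw [him hqim hz'q, him hqim hzq]
  · -- no horizontal-type segment passes through `z`: all segments through `z` are vertical-type
    push Not at hh
    refine Or.inr fun z' hz' hd => ?_
    obtain ⟨q, hq, hzq, hz'q⟩ := key z' hz' hd
    rcases hS q hq with hqre | hqim
    · rw [hre hqre hz'q, hre hqre hzq]
    · exact absurd hqim (hh q hq hzq)

/-- **Stub 5 of the line (`FiniteCorners`, inlined over tree vocabulary).** For a rectilinear conformal
rectangle, all but finitely many parameters `s ∈ [mark 1, mark 3]` are flat points of the boundary: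
for some `r > 0` the frontier within `r` of `R.boundary s` lies on the horizontal, or on the vertical,
line through `R.boundary s`. The exceptional parameters are those sent by the boundary loop (injective
on `[0,1) ⊇ [mark 1, mark 3]`) into the finite grid of crossings of the covering segments. [folklore] -/
theorem stub_finiteCorners :
    ∀ R : ConformalRectangle, IsRectilinear R →
      ∃ T : Finset ℝ, ∀ s ∈ Icc (R.mark 1) (R.mark 3), s ∉ T → ∃ r : ℝ, 0 < r ∧
        ((∀ z' ∈ frontier R.carrier, dist z' (R.boundary s) < r → z'.im = (R.boundary s).im) ∨
          (∀ z' ∈ frontier R.carrier, dist z' (R.boundary s) < r → z'.re = (R.boundary s).re)) := by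
  classical
  intro R hR
  obtain ⟨S, hS, hsub⟩ := hR
  set G : Finset ℂ := (S ×ˢ S).image fun pq : (ℂ × ℂ) × (ℂ × ℂ) => (⟨pq.2.1.re, pq.1.1.im⟩ : ℂ)
    with hG
  -- the boundary loop is injective on the parameter arc `[mark 1, mark 3] ⊆ [0, 1)`
  have h01 : Icc (R.mark 1) (R.mark 3) ⊆ Ico 0 1 := fun s hs =>
    ⟨(R.mark_mem 1).1.trans hs.1, hs.2.trans_lt (R.mark_mem 3).2⟩
  have hinj : InjOn R.boundary (Icc (R.mark 1) (R.mark 3)) := R.injOn_boundary.mono h01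
  -- so only finitely many parameters of the arc are sent into the grid `G`
  have hfin : (Icc (R.mark 1) (R.mark 3) ∩ R.boundary ⁻¹' (↑G : Set ℂ)).Finite :=
    Set.Finite.of_finite_image (G.finite_toSet.subset (image_subset_iff.2 fun s hs => hs.2))
      (hinj.mono inter_subset_left)
  refine ⟨hfin.toFinset, fun s hs hsT => ?_⟩
  have hz : R.boundary s ∉ G := fun h => hsT (hfin.mem_toFinset.2 ⟨hs, h⟩)
  exact exists_flat_near_of_not_mem_grid hS hsub hz

end Summit.CriticalPhenomena.CardyFormulaZ2.Cruxes.RectilinearCardy.ExcursionKernelCovariance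

end
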